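import Literature.Analysis.FunctionSpaces.TorusSobolevNormProofs
import Literature.Analysis.FunctionSpaces.TorusFourierCalculus
import HarnessLib

/-!
# Hölder continuous functions on `T^d` lie in `H^s` for `s < r` (Bernstein's embedding)

Analysis/FunctionSpaces support file for the spectral Sobolev scale `Torus.eSobolevNorm`
(`TorusSobolevNorm`). We prove the classical embedding `C^{0,r}(T^d) ⊂ H^s(T^d)` for
`0 ≤ s < r`, with an explicit constant: if `f : T^d → F` (`F` a complex Hilbert space) is
continuous, bounded by `M` and `r`-Hölder with constant `L` for the metric of the flat torus,
then

  `‖f‖²_{H^s} ≤ M² + C_{d,s,r} L²`,  `C_{d,s,r} = (card d) (1 + 4 card d)^s / (2 (1 - 4^{s-r}))`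

(`Torus.eSobolevNorm_sq_le_of_holder`), whence `‖f‖_{H^s} ≤ M + C_{d,s,r}^{1/2} L`
(`Torus.eSobolevNorm_le_of_holder`). This is Bernstein's argument (S. N. Bernstein 1914 for
`d = 1`; Bahouri–Chemin–Danchin 2011, §2.7 / Grafakos 2014, §3.3 for the Fourier side): the
Fourier coefficients of the translate `f(· + h)` are `e_k(h) f̂(k)` (`mFourierCoeff_comp_add_right`),
so by Parseval `∑_k |e_k(h) - 1|² ‖f̂(k)‖² = ‖f(· + h) - f‖²_{L²} ≤ L² |h|^{2r}`; for `k` in the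
dyadic shell `2^j ≤ |k|_∞ < 2^{j+1}` and `h` the point with the single non-zero coordinate
`2^{-j-2}` in the direction where `|k_i| = |k|_∞` one has `|e_k(h) - 1|² = 2 - 2cos(2π kᵢ 2^{-j-2}) ≥ 2`,
so the shell carries `L²`-mass `≤ (card d / 2) L² 4^{-(j+2) r}` while its Sobolev weight is
`≤ (1 + 4 card d)^s 4^{js}`; summing the geometric series in `j` gives the claim.

## Contents

* `Torus.mFourierCoeff_comp_add_right` — `𝓕(f(· + h))(k) = e_k(h) • f̂(k)`;
* `Torus.two_le_norm_exp_sub_one_sq` — `2 ≤ ‖exp(2πiθ) - 1‖²` for `1/4 ≤ |θ| ≤ 1/2`, and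
  `Torus.two_le_norm_mFourier_dyadicShift_sub_one_sq` — its instance for a character on its
  dyadic translate;
* the dyadic bookkeeping `Torus.supNorm k = maxᵢ |kᵢ|`, `Torus.dyadicLevel k = ⌊log₂ |k|_∞⌋`,
  `Torus.dyadicDir k i₀` (a coordinate realising the maximum), `Torus.dyadicShift j i` (the
  translate by `2^{-(j+2)}` in direction `i`), `Torus.sobolevWeight_sq_le_dyadic`;
* `Torus.eSobolevNorm_sq_le_of_holder`, `Torus.eSobolevNorm_le_of_holder` — the embedding.

## Mathlib search

Mathlib (this pin) has the characters and coefficients on `UnitAddTorus d`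
(`UnitAddTorus.mFourier`, `mFourierCoeff`, Parseval `hasSum_sq_mFourierCoeff` for `L²` classes)
and Hölder classes (`HolderWith`), but no Sobolev scale on the torus and no Bernstein-type
embedding (searched `Bernstein`, `Holder` + `Fourier`: only `Polynomial.bernstein`). The tree has
the spectral norm (`TorusSobolevNorm`) and Parseval for honest functions
(`Torus.tsum_enorm_sq_mFourierCoeff_eq_eLpNorm_sq`, `TorusSobolevNormProofs`); the embedding
`H^s ⊂ C^{0,r}` in the *opposite* direction is the named fact `Torus.MemSobolev.memHolder_of_lt`.

## References

* H. Bahouri, J.-Y. Chemin, R. Danchin, *Fourier Analysis and Nonlinear Partial Differential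
  Equations*, Springer 2011, §2.7 (Hölder–Zygmund spaces as Besov spaces `B^r_{∞,∞}`, and
  `B^r_{∞,∞}(T^d) ⊂ B^s_{2,2} = H^s` for `s < r` on a compact torus).
* L. Grafakos, *Classical Fourier Analysis*, 3rd ed., Springer 2014, §3.3.
-/

open MeasureTheory Set Filter UnitAddTorus
open scoped ENNReal NNReal

noncomputable section

namespace Literature.Analysis.FunctionSpaces

namespace Torus

variable {d : Type*} [Fintype d]
variable {F : Type*} [NormedAddCommGroup F]

/-! ## Fourier coefficients of translates -/

section Translate

variable [NormedSpace ℂ F]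

/-- `e_{-k}(x - h) = e_{-k}(x) e_k(h)`. [folklore] -/
theorem mFourier_neg_apply_sub (k : d → ℤ) (x h : UnitAddTorus d) :
    mFourier (-k) (x - h) = mFourier (-k) x * mFourier k h := by
  have h1 : mFourier (-k) (x - h) * mFourier (-k) h = mFourier (-k) x := by
    rw [← mFourier_apply_add, sub_add_cancel]
  have h2 : mFourier (-k) h * mFourier k h = 1 := by
    rw [← mFourier_add, neg_add_cancel, mFourier_zero]
    rfl
  calc mFourier (-k) (x - h) = mFourier (-k) (x - h) * (mFourier (-k) h * mFourier k h) := by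
        rw [h2, mul_one]
    _ = mFourier (-k) x * mFourier k h := by rw [← mul_assoc, h1]

/-- **Fourier coefficients of a translate**: `𝓕(f(· + h))(k) = e_k(h) • f̂(k)` (translation
invariance of the Haar measure; Grafakos 2014, Prop. 3.2.2 (6) on `T^n`). [folklore] -/
theorem mFourierCoeff_comp_add_right (f : UnitAddTorus d → F) (h : UnitAddTorus d) (k : d → ℤ) :
    mFourierCoeff (fun x => f (x + h)) k = mFourier k h • mFourierCoeff f k := by
  rw [mFourierCoeff_eq_integral_volume, mFourierCoeff_eq_integral_volume]
  have h1 : (fun x => mFourier (-k) x • f (x + h)) =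
      fun x => (fun y => mFourier (-k) (y - h) • f y) (x + h) := by
    funext x
    simp only [add_sub_cancel_right]
  rw [h1, integral_add_right_eq_self (fun y => mFourier (-k) (y - h) • f y) h]
  simp_rw [mFourier_neg_apply_sub k _ h, mul_comm (mFourier (-k) _) (mFourier k h), mul_smul,
    integral_smul]

/-- Fourier coefficients of the increment: `𝓕(f(· + h) - f)(k) = (e_k(h) - 1) • f̂(k)` for
integrable `f`. [folklore] -/
theorem mFourierCoeff_comp_add_right_sub {f : UnitAddTorus d → F} (hf : Integrable f volume)
    (h : UnitAddTorus d) (k : d → ℤ) :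
    mFourierCoeff (fun x => f (x + h) - f x) k = (mFourier k h - 1) • mFourierCoeff f k := by
  have hfh : Integrable (fun x => f (x + h)) volume := hf.comp_add_right h
  have h1 : (fun x => f (x + h) - f x) = (fun x => f (x + h)) + -f := by
    funext x
    simp [sub_eq_add_neg]
  rw [h1, mFourierCoeff_add hfh hf.neg, mFourierCoeff_neg, mFourierCoeff_comp_add_right, sub_smul,
    one_smul, ← sub_eq_add_neg]

end Translate

/-! ## The lower bound `|e^{2πiθ} - 1|² ≥ 2` for `1/4 ≤ |θ| ≤ 1/2` -/

section Character

/-- `‖exp(iα) - 1‖² = 2 - 2 cos α`. [folklore] -/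
theorem norm_exp_mul_I_sub_one_sq (α : ℝ) :
    ‖Complex.exp (α * Complex.I) - 1‖ ^ 2 = 2 - 2 * Real.cos α := by
  rw [Complex.sq_norm, Complex.normSq_apply]
  simp only [Complex.sub_re, Complex.exp_ofReal_mul_I_re, Complex.one_re, Complex.sub_im,
    Complex.exp_ofReal_mul_I_im, Complex.one_im, sub_zero]
  nlinarith [Real.cos_sq_add_sin_sq α]

/-- For `1/4 ≤ |θ| ≤ 1/2` the character value `exp(2πiθ)` lies in the closed left half plane, so
`2 ≤ ‖exp(2πiθ) - 1‖²`. [folklore] -/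
theorem two_le_norm_exp_sub_one_sq {θ : ℝ} (h1 : 1 / 4 ≤ |θ|) (h2 : |θ| ≤ 1 / 2) :
    2 ≤ ‖Complex.exp (2 * Real.pi * Complex.I * θ) - 1‖ ^ 2 := by
  have hcos : Real.cos (2 * Real.pi * θ) ≤ 0 := by
    have h : Real.cos (2 * Real.pi * θ) = Real.cos (2 * Real.pi * |θ|) := by
      rcases abs_choice θ with hθ | hθ
      · rw [hθ]
      · rw [hθ, mul_neg, Real.cos_neg]
    rw [h]
    refine Real.cos_nonpos_of_pi_div_two_le_of_le ?_ ?_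
    · nlinarith [Real.pi_pos]
    · nlinarith [Real.pi_pos]
  have heq : Complex.exp (2 * Real.pi * Complex.I * θ) =
      Complex.exp ((2 * Real.pi * θ : ℝ) * Complex.I) := by
    congr 1
    push_cast
    ring
  rw [heq, norm_exp_mul_I_sub_one_sq]
  linarith

/-- The value of a character `e_k` at the point with a single non-zero coordinate `t` in
direction `i` is `exp(2πi kᵢ t)`. [folklore] -/
theorem mFourier_pi_single [DecidableEq d] (k : d → ℤ) (i : d) (t : ℝ) :
    mFourier k (Pi.single i (t : UnitAddCircle) : UnitAddTorus d) =
      Complex.exp (2 * Real.pi * Complex.I * ((k i : ℝ) * t : ℝ)) := by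
  simp only [mFourier, ContinuousMap.coe_mk]
  rw [Finset.prod_eq_single i]
  · rw [Pi.single_eq_same, fourier_coe_apply]
    congr 1
    push_cast
    ring
  · intro j _ hj
    rw [Pi.single_eq_of_ne hj]
    exact fourier_eval_zero (k j)
  · intro hi
    exact absurd (Finset.mem_univ i) hi

end Character

/-! ## Dyadic bookkeeping on `ℤ^d` -/

section Dyadic

/-- The sup norm `|k|_∞ = maxᵢ |kᵢ|` of a frequency (`0` for the empty index type). [folklore] -/
def supNorm (k : d → ℤ) : ℕ :=
  Finset.univ.sup fun i => (k i).natAbs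

/-- `|kᵢ| ≤ |k|_∞`. [folklore] -/
theorem natAbs_le_supNorm (k : d → ℤ) (i : d) : (k i).natAbs ≤ supNorm k :=
  Finset.le_sup (f := fun i => (k i).natAbs) (Finset.mem_univ i)

/-- A non-zero frequency has a coordinate realising `|k|_∞`, which is then positive. [folklore] -/
theorem exists_natAbs_eq_supNorm {k : d → ℤ} (hk : k ≠ 0) :
    ∃ i, (k i).natAbs = supNorm k ∧ 0 < supNorm k := by
  classical
  obtain ⟨i₀, hi₀⟩ : ∃ i, k i ≠ 0 := Function.ne_iff.1 hk
  have hne : (Finset.univ : Finset d).Nonempty := ⟨i₀, Finset.mem_univ _⟩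
  obtain ⟨i, -, hi⟩ := Finset.exists_max_image Finset.univ (fun i => (k i).natAbs) hne
  refine ⟨i, le_antisymm (natAbs_le_supNorm k i) (Finset.sup_le fun j _ => hi j (Finset.mem_univ j)),
    ?_⟩
  exact lt_of_lt_of_le (Int.natAbs_pos.2 hi₀) (natAbs_le_supNorm k i₀)

/-- The dyadic level `j(k) = ⌊log₂ |k|_∞⌋` of a frequency. [folklore] -/
def dyadicLevel (k : d → ℤ) : ℕ :=
  Nat.log 2 (supNorm k)

/-- `2^{j(k)} ≤ |k|_∞ < 2^{j(k)+1}` for `k ≠ 0`. [folklore] -/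
theorem pow_dyadicLevel_le {k : d → ℤ} (hk : k ≠ 0) :
    2 ^ dyadicLevel k ≤ supNorm k ∧ supNorm k < 2 ^ (dyadicLevel k + 1) := by
  obtain ⟨_, _, hpos⟩ := exists_natAbs_eq_supNorm hk
  exact ⟨Nat.pow_log_le_self 2 hpos.ne', Nat.lt_pow_succ_log_self one_lt_two _⟩

/-- A coordinate direction realising `|k|_∞` (junk: an arbitrary direction when none exists, which
happens only for `k = 0` or the empty index type — callers assume `k ≠ 0`). [folklore] -/
def dyadicDir (k : d → ℤ) (i₀ : d) : d :=
  by classical exact if h : ∃ i, (k i).natAbs = supNorm k then h.choose else i₀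

/-- The chosen direction realises the sup norm. [folklore] -/
theorem natAbs_dyadicDir {k : d → ℤ} (hk : k ≠ 0) (i₀ : d) :
    (k (dyadicDir k i₀)).natAbs = supNorm k := by
  classical
  have h : ∃ i, (k i).natAbs = supNorm k := by
    obtain ⟨i, hi, -⟩ := exists_natAbs_eq_supNorm hk
    exact ⟨i, hi⟩
  unfold dyadicDir
  rw [dif_pos h]
  exact h.choose_spec

/-- The dyadic translate at level `j` in direction `i`: the point of `T^d` whose only non-zero
coordinate is `2^{-(j+2)}` in direction `i`. [folklore] -/
def dyadicShift (j : ℕ) (i : d) : UnitAddTorus d :=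
  by classical exact Pi.single i (((2 : ℝ) ^ (j + 2))⁻¹ : ℝ)

/-- The dyadic translate is within `2^{-(j+2)}` of the origin. [folklore] -/
theorem norm_dyadicShift_le (j : ℕ) (i : d) : ‖(dyadicShift j i : UnitAddTorus d)‖ ≤ ((2 : ℝ) ^ (j + 2))⁻¹ := by
  classical
  have h0 : (0 : ℝ) ≤ ((2 : ℝ) ^ (j + 2))⁻¹ := by positivity
  refine (pi_norm_le_iff_of_nonneg h0).2 fun l => ?_
  unfold dyadicShift
  by_cases hl : l = i
  · subst hl
    rw [Pi.single_eq_same, (AddCircle.norm_coe_eq_abs_iff (1 : ℝ) one_ne_zero).2]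
    · rw [abs_of_nonneg h0]
    · rw [abs_of_nonneg h0, abs_one]
      have : (4 : ℝ) ≤ 2 ^ (j + 2) := by
        calc (4 : ℝ) = 2 ^ 2 := by norm_num
          _ ≤ 2 ^ (j + 2) := pow_le_pow_right₀ one_le_two (by omega)
      rw [inv_le_comm₀ (by positivity) (by norm_num)]
      linarith
  · rw [Pi.single_eq_of_ne hl, norm_zero]
    exact h0

/-- **The key lower bound.** For `k ≠ 0` at dyadic level `j` and a direction `i` with
`|kᵢ| = |k|_∞`, the character `e_k` at the dyadic translate satisfies `2 ≤ ‖e_k(h) - 1‖²`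
(its phase `kᵢ 2^{-(j+2)}` has modulus in `[1/4, 1/2)`). [folklore] -/
theorem two_le_norm_mFourier_dyadicShift_sub_one_sq {k : d → ℤ} (hk : k ≠ 0) (i₀ : d) :
    2 ≤ ‖mFourier k (dyadicShift (dyadicLevel k) (dyadicDir k i₀)) - 1‖ ^ 2 := by
  classical
  set i := dyadicDir k i₀ with hi
  set j := dyadicLevel k with hj
  have hshift : (dyadicShift j i : UnitAddTorus d) = Pi.single i ((((2 : ℝ) ^ (j + 2))⁻¹ : ℝ) : UnitAddCircle) := by
    unfold dyadicShift
    congr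
  rw [hshift, mFourier_pi_single]
  obtain ⟨hlo, hhi⟩ := pow_dyadicLevel_le hk
  have hki : (k i).natAbs = supNorm k := natAbs_dyadicDir hk i₀
  have habs : |(k i : ℝ)| = (supNorm k : ℝ) := by
    have h1 : ((supNorm k : ℕ) : ℝ) = (((k i).natAbs : ℤ) : ℝ) := by
      rw [hki]
      norm_cast
    rw [Int.natCast_natAbs, Int.cast_abs] at h1
    exact h1.symm
  have hpos : (0 : ℝ) < 2 ^ (j + 2) := by positivity
  refine two_le_norm_exp_sub_one_sq ?_ ?_
  · rw [abs_mul, habs, abs_of_pos (inv_pos.2 hpos), ← div_eq_mul_inv, le_div_iff₀ hpos]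
    have : ((2 : ℕ) ^ j : ℕ) ≤ (supNorm k : ℝ) := by exact_mod_cast hlo
    push_cast at this
    calc 1 / 4 * (2 : ℝ) ^ (j + 2) = 2 ^ j := by ring
      _ ≤ supNorm k := this
  · rw [abs_mul, habs, abs_of_pos (inv_pos.2 hpos), ← div_eq_mul_inv, div_le_iff₀ hpos]
    have : (supNorm k : ℝ) + 1 ≤ ((2 : ℕ) ^ (j + 1) : ℕ) := by exact_mod_cast hhi
    push_cast at this
    calc (supNorm k : ℝ) ≤ 2 ^ (j + 1) := by linarith
      _ = 1 / 2 * 2 ^ (j + 2) := by ring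

/-- The Sobolev weight on the dyadic shell: `(1 + |k|²)^s ≤ (1 + 4 card d)^s 4^{s j(k)}` for
`s ≥ 0`, since `|k|² ≤ card d · |k|²_∞ < 4 card d · 4^{j(k)}`. [folklore] -/
theorem sobolevWeight_sq_le_dyadic {s : ℝ} (hs : 0 ≤ s) {k : d → ℤ} (hk : k ≠ 0) :
    sobolevWeight s k ^ 2 ≤ (1 + 4 * Fintype.card d) ^ s * ((4 : ℝ) ^ s) ^ dyadicLevel k := by
  obtain ⟨-, hhi⟩ := pow_dyadicLevel_le hk
  set j := dyadicLevel k with hj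
  have hN : (supNorm k : ℝ) ≤ 2 ^ (j + 1) := by
    have : (supNorm k : ℝ) + 1 ≤ ((2 : ℕ) ^ (j + 1) : ℕ) := by exact_mod_cast hhi
    push_cast at this
    linarith
  have hcoord : ∀ i, ((k i : ℝ)) ^ 2 ≤ 4 * 4 ^ j := by
    intro i
    have h1 : |(k i : ℝ)| ≤ supNorm k := by
      have h3 : (((k i).natAbs : ℤ) : ℝ) ≤ ((supNorm k : ℕ) : ℝ) := by
        exact_mod_cast natAbs_le_supNorm k i
      rwa [Int.natCast_natAbs, Int.cast_abs] at h3
    have h2 : |(k i : ℝ)| ≤ 2 ^ (j + 1) := h1.trans hN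
    calc ((k i : ℝ)) ^ 2 = |(k i : ℝ)| ^ 2 := (sq_abs _).symm
      _ ≤ (2 ^ (j + 1)) ^ 2 := pow_le_pow_left₀ (abs_nonneg _) h2 2
      _ = 4 * 4 ^ j := by
          rw [← pow_mul, mul_comm (j + 1) 2, pow_mul]
          norm_num
          ring
  have hfreq : freqNormSq k ≤ Fintype.card d * (4 * 4 ^ j) := by
    unfold freqNormSq
    calc ∑ i, ((k i : ℝ)) ^ 2 ≤ ∑ _i : d, (4 * (4 : ℝ) ^ j) := Finset.sum_le_sum fun i _ => hcoord i
      _ = Fintype.card d * (4 * 4 ^ j) := by rw [Finset.sum_const, Finset.card_univ, nsmul_eq_mul]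
  have hbase : 1 + freqNormSq k ≤ (1 + 4 * Fintype.card d) * 4 ^ j := by
    have h4 : (1 : ℝ) ≤ 4 ^ j := one_le_pow₀ (by norm_num)
    have hd : (0 : ℝ) ≤ Fintype.card d := Nat.cast_nonneg _
    nlinarith
  have hpos : 0 < 1 + freqNormSq k := by linarith [freqNormSq_nonneg k]
  calc sobolevWeight s k ^ 2 = (1 + freqNormSq k) ^ s := by
        rw [sobolevWeight, ← Real.rpow_natCast, ← Real.rpow_mul hpos.le]
        norm_num
    _ ≤ ((1 + 4 * Fintype.card d) * 4 ^ j) ^ s := Real.rpow_le_rpow hpos.le hbase hs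
    _ = (1 + 4 * Fintype.card d) ^ s * ((4 : ℝ) ^ s) ^ j := by
        rw [Real.mul_rpow (by positivity) (by positivity), ← Real.rpow_natCast,
          ← Real.rpow_natCast, ← Real.rpow_mul (by norm_num), ← Real.rpow_mul (by norm_num),
          mul_comm (j : ℝ) s]

end Dyadic

/-! ## The embedding -/

section Embedding

/-- Splitting one term off an `ℝ≥0∞`-valued series, with the ambient decidability of equality
(Mathlib's `ENNReal.tsum_eq_add_tsum_ite` fixes the classical instance). [folklore] -/
theorem tsum_eq_add_tsum_ite_of_decidableEq {β : Type*} [DecidableEq β] (g : β → ℝ≥0∞) (b : β) :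
    ∑' x, g x = g b + ∑' x, if x = b then 0 else g x :=
  ENNReal.summable.tsum_eq_add_tsum_ite' b

/-- `((2^{j+2})⁻¹)^r)² = 4^{-2r} (4^{-r})^j`. [folklore] -/
theorem inv_two_pow_rpow_sq (j : ℕ) (r : ℝ) :
    ((((2 : ℝ) ^ (j + 2))⁻¹) ^ r) ^ 2 = (4 : ℝ) ^ (-(2 * r)) * ((4 : ℝ) ^ (-r)) ^ j := by
  have h4 : (0 : ℝ) ≤ 4 := by norm_num
  have ht : (0 : ℝ) ≤ (2 : ℝ) ^ (j + 2) := by positivity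
  have e1 : (((2 : ℝ) ^ (j + 2))⁻¹) ^ r = ((4 : ℝ) ^ (j + 2)) ^ (-(r / 2)) := by
    rw [Real.inv_rpow ht, Real.rpow_neg (by positivity), show (4 : ℝ) = 2 ^ 2 by norm_num,
      ← pow_mul, ← Real.rpow_natCast (2 : ℝ) (2 * (j + 2)), ← Real.rpow_natCast (2 : ℝ) (j + 2),
      ← Real.rpow_mul zero_le_two, ← Real.rpow_mul zero_le_two]
    congr 2
    push_cast
    ring
  rw [e1, ← Real.rpow_mul_natCast (by positivity), ← Real.rpow_natCast (4 : ℝ) (j + 2),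
    ← Real.rpow_mul h4, ← Real.rpow_mul_natCast h4, ← Real.rpow_add (by norm_num)]
  congr 1
  push_cast
  ring

/-- `L²` smallness of Hölder increments: if `‖f(x) - f(y)‖ ≤ L dist(x,y)^r` then
`‖f(· + h) - f‖_{L²(T^d)} ≤ L ‖h‖^r` (the torus has total mass one). [folklore] -/
theorem eLpNorm_comp_add_right_sub_le {f : UnitAddTorus d → F} {L r : ℝ}
    (hf : ∀ x y, ‖f x - f y‖ ≤ L * dist x y ^ r) (h : UnitAddTorus d) :
    eLpNorm (fun x => f (x + h) - f x) 2 volume ≤ ENNReal.ofReal (L * ‖h‖ ^ r) := by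
  have hb : ∀ᵐ x ∂(volume : Measure (UnitAddTorus d)), ‖f (x + h) - f x‖ ≤ L * ‖h‖ ^ r := by
    refine Eventually.of_forall fun x => ?_
    have := hf (x + h) x
    rwa [dist_eq_norm, add_sub_cancel_left] at this
  refine (eLpNorm_le_of_ae_bound hb).trans ?_
  simp

variable [InnerProductSpace ℂ F] [CompleteSpace F]

/-- **Bernstein's embedding `C^{0,r}(T^d) ⊂ H^s(T^d)`, squared form.** For `0 ≤ s < r` and a
continuous `f : T^d → F` with `‖f‖ ≤ M` and `‖f(x) - f(y)‖ ≤ L dist(x,y)^r`,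
`‖f‖²_{H^s} ≤ M² + (card d) (1 + 4 card d)^s 4^{-2r} (2 (1 - 4^{s-r}))⁻¹ L²`
(Bahouri–Chemin–Danchin 2011, §2.7; Grafakos 2014, §3.3). [folklore] -/
theorem eSobolevNorm_sq_le_of_holder {s r : ℝ} (hs : 0 ≤ s) (hsr : s < r) {f : UnitAddTorus d → F}
    (hfc : Continuous f) {M L : ℝ} (hL : 0 ≤ L) (hfM : ∀ x, ‖f x‖ ≤ M)
    (hfL : ∀ x y, ‖f x - f y‖ ≤ L * dist x y ^ r) :
    eSobolevNorm s f ^ 2 ≤ ENNReal.ofReal (M ^ 2 +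
      Fintype.card d * (1 + 4 * Fintype.card d) ^ s * (4 : ℝ) ^ (-(2 * r)) *
        (2 * (1 - (4 : ℝ) ^ (s - r)))⁻¹ * L ^ 2) := by
  classical
  have hfi : Integrable f volume := hfc.integrable_unitAddTorus
  -- Step 0: unfold the squared norm as a sum over frequencies
  have hsq : eSobolevNorm s f ^ 2 =
      ∑' k : d → ℤ, ENNReal.ofReal (sobolevWeight s k ^ 2) * ‖mFourierCoeff f k‖ₑ ^ 2 := by
    rw [eSobolevNorm, ← ENNReal.rpow_natCast, ← ENNReal.rpow_mul]
    norm_num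
  rw [hsq, tsum_eq_add_tsum_ite_of_decidableEq _ (0 : d → ℤ)]
  -- Step 1: the zero mode
  have hzero : ENNReal.ofReal (sobolevWeight s (0 : d → ℤ) ^ 2) * ‖mFourierCoeff f 0‖ₑ ^ 2 ≤
      ENNReal.ofReal (M ^ 2) := by
    rw [sobolevWeight_apply_zero, one_pow, ENNReal.ofReal_one, one_mul]
    have hpt : ∀ x, ‖mFourier (-0) x • f x‖ ≤ M := by
      intro x
      rw [norm_smul]
      have : ‖mFourier (-0) x‖ ≤ 1 := by
        rw [neg_zero, mFourier_zero]
        simp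
      calc ‖(mFourier (-0)) x‖ * ‖f x‖ ≤ 1 * M :=
            mul_le_mul this (hfM x) (norm_nonneg _) zero_le_one
        _ = M := one_mul M
    have h1 : ‖mFourierCoeff f 0‖ ≤ M := by
      rw [mFourierCoeff_eq_integral_volume]
      refine (norm_integral_le_integral_norm _).trans ?_
      calc ∫ x, ‖mFourier (-0) x • f x‖ ≤ ∫ _x : UnitAddTorus d, M :=
            integral_mono_of_nonneg (Eventually.of_forall fun _ => norm_nonneg _)
              (integrable_const M) (Eventually.of_forall hpt)
        _ = M := by simp
    rw [← ofReal_norm, ← ENNReal.ofReal_pow (norm_nonneg _)]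
    exact ENNReal.ofReal_le_ofReal (pow_le_pow_left₀ (norm_nonneg _) h1 2)
  -- Step 2: the bound for a single non-zero frequency
  obtain hd | ⟨⟨i₀⟩⟩ := isEmpty_or_nonempty d
  · -- empty index type: every frequency is zero
    have hall : ∀ k : d → ℤ, k = 0 := fun k => funext fun i => (hd.false i).elim
    have hrest : (∑' k : d → ℤ, if k = 0 then 0 else
        ENNReal.ofReal (sobolevWeight s k ^ 2) * ‖mFourierCoeff f k‖ₑ ^ 2) = 0 := by
      rw [ENNReal.tsum_eq_zero]
      intro k
      rw [if_pos (hall k)]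
    rw [hrest, add_zero]
    refine hzero.trans (ENNReal.ofReal_le_ofReal ?_)
    have hq : (4 : ℝ) ^ (s - r) < 1 := Real.rpow_lt_one_of_one_lt_of_neg (by norm_num) (by linarith)
    have : 0 ≤ Fintype.card d * (1 + 4 * Fintype.card d) ^ s * (4 : ℝ) ^ (-(2 * r)) *
        (2 * (1 - (4 : ℝ) ^ (s - r)))⁻¹ * L ^ 2 := by
      have h1 : (0 : ℝ) ≤ Fintype.card d := Nat.cast_nonneg _
      have h2 : (0 : ℝ) < (2 * (1 - (4 : ℝ) ^ (s - r)))⁻¹ := by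
        rw [inv_pos]; linarith
      positivity
    linarith
  -- constants
  set A : ℝ := (1 + 4 * Fintype.card d) ^ s with hA
  set q : ℝ := (4 : ℝ) ^ s with hq_def
  have hA0 : 0 ≤ A := by positivity
  have hq0 : 0 ≤ q := by positivity
  -- the comparison sequence
  set G : ℕ → d → (d → ℤ) → ℝ≥0∞ := fun j i k =>
    ENNReal.ofReal (A * q ^ j / 2) * ‖mFourierCoeff (fun x => f (x + dyadicShift j i) - f x) k‖ₑ ^ 2
    with hG
  have hterm : ∀ k : d → ℤ, k ≠ 0 →
      ENNReal.ofReal (sobolevWeight s k ^ 2) * ‖mFourierCoeff f k‖ₑ ^ 2 ≤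
        G (dyadicLevel k) (dyadicDir k i₀) k := by
    intro k hk
    set j := dyadicLevel k
    set i := dyadicDir k i₀
    have hcoef : mFourierCoeff (fun x => f (x + dyadicShift j i) - f x) k =
        (mFourier k (dyadicShift j i) - 1) • mFourierCoeff f k :=
      mFourierCoeff_comp_add_right_sub hfi _ k
    have h2 : (2 : ℝ≥0∞) ≤ ‖mFourier k (dyadicShift j i) - 1‖ₑ ^ 2 := by
      have h := two_le_norm_mFourier_dyadicShift_sub_one_sq hk i₀
      have : ENNReal.ofReal 2 ≤ ENNReal.ofReal (‖mFourier k (dyadicShift j i) - 1‖ ^ 2) :=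
        ENNReal.ofReal_le_ofReal h
      rwa [ENNReal.ofReal_ofNat, ENNReal.ofReal_pow (norm_nonneg _), ofReal_norm] at this
    have hw : ENNReal.ofReal (sobolevWeight s k ^ 2) ≤ ENNReal.ofReal (A * q ^ j) :=
      ENNReal.ofReal_le_ofReal (sobolevWeight_sq_le_dyadic hs hk)
    simp only [hG]
    rw [hcoef, enorm_smul, mul_pow]
    calc ENNReal.ofReal (sobolevWeight s k ^ 2) * ‖mFourierCoeff f k‖ₑ ^ 2
        ≤ ENNReal.ofReal (A * q ^ j) * ‖mFourierCoeff f k‖ₑ ^ 2 := by gcongr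
      _ = ENNReal.ofReal (A * q ^ j / 2) * 2 * ‖mFourierCoeff f k‖ₑ ^ 2 := by
          rw [← ENNReal.ofReal_ofNat 2, ← ENNReal.ofReal_mul (by positivity)]
          congr 2
          ring
      _ ≤ ENNReal.ofReal (A * q ^ j / 2) * ‖mFourier k (dyadicShift j i) - 1‖ₑ ^ 2 *
            ‖mFourierCoeff f k‖ₑ ^ 2 := by gcongr
      _ = ENNReal.ofReal (A * q ^ j / 2) *
            (‖mFourier k (dyadicShift j i) - 1‖ₑ ^ 2 * ‖mFourierCoeff f k‖ₑ ^ 2) := by ring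
  -- Step 3: regroup the sum over non-zero frequencies by (level, direction)
  have hregroup : (∑' k : d → ℤ, if k = 0 then 0 else
      ENNReal.ofReal (sobolevWeight s k ^ 2) * ‖mFourierCoeff f k‖ₑ ^ 2) ≤
      ∑' j : ℕ, ∑' i : d, ∑' k : d → ℤ, G j i k := by
    calc (∑' k : d → ℤ, if k = 0 then 0 else
          ENNReal.ofReal (sobolevWeight s k ^ 2) * ‖mFourierCoeff f k‖ₑ ^ 2)
        ≤ ∑' k : d → ℤ, ∑' j : ℕ, ∑' i : d,
            if j = dyadicLevel k ∧ i = dyadicDir k i₀ then G j i k else 0 := by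
          refine ENNReal.tsum_le_tsum fun k => ?_
          by_cases hk : k = 0
          · rw [if_pos hk]; exact zero_le
          · rw [if_neg hk, tsum_eq_add_tsum_ite_of_decidableEq _ (dyadicLevel k)]
            refine le_add_right ?_
            rw [tsum_eq_add_tsum_ite_of_decidableEq _ (dyadicDir k i₀)]
            refine le_add_right ?_
            rw [if_pos ⟨rfl, rfl⟩]
            exact hterm k hk
      _ = ∑' j : ℕ, ∑' i : d, ∑' k : d → ℤ,
            if j = dyadicLevel k ∧ i = dyadicDir k i₀ then G j i k else 0 := by
          rw [ENNReal.tsum_comm]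
          refine tsum_congr fun j => ?_
          rw [ENNReal.tsum_comm]
      _ ≤ ∑' j : ℕ, ∑' i : d, ∑' k : d → ℤ, G j i k := by
          gcongr with j i k
          split_ifs
          · exact le_rfl
          · exact zero_le
  -- Step 4: Parseval and the Hölder bound at each (level, direction)
  have hlevel : ∀ (j : ℕ) (i : d), ∑' k : d → ℤ, G j i k ≤
      ENNReal.ofReal (A * q ^ j / 2 * (L ^ 2 * ((4 : ℝ) ^ (-(2 * r)) * ((4 : ℝ) ^ (-r)) ^ j))) := by
    intro j i
    have hgc : Continuous fun x => f (x + dyadicShift j i) - f x :=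
      (hfc.comp (continuous_id.add continuous_const)).sub hfc
    have hgm : MemLp (fun x => f (x + dyadicShift j i) - f x) 2 volume :=
      hgc.memLp_of_hasCompactSupport (HasCompactSupport.of_compactSpace _)
    simp only [hG]
    rw [ENNReal.tsum_mul_left, tsum_enorm_sq_mFourierCoeff_eq_eLpNorm_sq hgm,
      ENNReal.ofReal_mul (by positivity)]
    gcongr
    -- `‖f(· + h) - f‖²_{L²} ≤ L² ‖h‖^{2r} ≤ L² 4^{-(j+2) r}`
    set h := (dyadicShift j i : UnitAddTorus d) with hh
    have h1 : eLpNorm (fun x => f (x + h) - f x) 2 volume ≤ ENNReal.ofReal (L * ‖h‖ ^ r) :=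
      eLpNorm_comp_add_right_sub_le hfL h
    have hr0 : 0 < r := lt_of_le_of_lt hs hsr
    have h2 : L * ‖h‖ ^ r ≤ L * (((2 : ℝ) ^ (j + 2))⁻¹) ^ r :=
      mul_le_mul_of_nonneg_left (Real.rpow_le_rpow (norm_nonneg _) (norm_dyadicShift_le j i) hr0.le) hL
    have h3 := inv_two_pow_rpow_sq j r
    calc eLpNorm (fun x => f (x + h) - f x) 2 volume ^ 2
        ≤ ENNReal.ofReal (L * (((2 : ℝ) ^ (j + 2))⁻¹) ^ r) ^ 2 := by
          gcongr
          exact h1.trans (ENNReal.ofReal_le_ofReal h2)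
      _ = ENNReal.ofReal (L ^ 2 * ((4 : ℝ) ^ (-(2 * r)) * ((4 : ℝ) ^ (-r)) ^ j)) := by
          rw [← ENNReal.ofReal_pow (by positivity), mul_pow, h3]
  -- Step 5: sum the geometric series
  have hρ : (4 : ℝ) ^ (s - r) < 1 := Real.rpow_lt_one_of_one_lt_of_neg (by norm_num) (by linarith)
  have hρ0 : 0 ≤ (4 : ℝ) ^ (s - r) := by positivity
  have hqr : ∀ j : ℕ, q ^ j * ((4 : ℝ) ^ (-r)) ^ j = ((4 : ℝ) ^ (s - r)) ^ j := by
    intro j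
    rw [← mul_pow, hq_def, ← Real.rpow_add (by norm_num), sub_eq_add_neg]
  have hsum : ∑' j : ℕ, ∑' i : d, ∑' k : d → ℤ, G j i k ≤
      ENNReal.ofReal (Fintype.card d * A * (4 : ℝ) ^ (-(2 * r)) * (2 * (1 - (4 : ℝ) ^ (s - r)))⁻¹ *
        L ^ 2) := by
    calc ∑' j : ℕ, ∑' i : d, ∑' k : d → ℤ, G j i k
        ≤ ∑' j : ℕ, ∑' _i : d,
            ENNReal.ofReal (A * q ^ j / 2 * (L ^ 2 * ((4 : ℝ) ^ (-(2 * r)) * ((4 : ℝ) ^ (-r)) ^ j))) := by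
          gcongr with j i
          exact hlevel j i
      _ = ∑' j : ℕ, ENNReal.ofReal (Fintype.card d * A / 2 * L ^ 2 * (4 : ℝ) ^ (-(2 * r))) *
            ENNReal.ofReal ((4 : ℝ) ^ (s - r)) ^ j := by
          refine tsum_congr fun j => ?_
          have e1 : (Fintype.card d : ℝ) * (A * q ^ j / 2 * (L ^ 2 * ((4 : ℝ) ^ (-(2 * r)) *
              ((4 : ℝ) ^ (-r)) ^ j))) = Fintype.card d * A / 2 * L ^ 2 * (4 : ℝ) ^ (-(2 * r)) *
              ((4 : ℝ) ^ (s - r)) ^ j := by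
            rw [← hqr j]
            ring
          rw [tsum_fintype, Finset.sum_const, Finset.card_univ, nsmul_eq_mul,
            ← ENNReal.ofReal_natCast, ← ENNReal.ofReal_mul (Nat.cast_nonneg _), e1,
            ENNReal.ofReal_mul (by positivity), ENNReal.ofReal_pow hρ0]
      _ = ENNReal.ofReal (Fintype.card d * A / 2 * L ^ 2 * (4 : ℝ) ^ (-(2 * r))) *
            (1 - ENNReal.ofReal ((4 : ℝ) ^ (s - r)))⁻¹ := by
          rw [ENNReal.tsum_mul_left, ENNReal.tsum_geometric]
      _ = ENNReal.ofReal (Fintype.card d * A * (4 : ℝ) ^ (-(2 * r)) * (2 * (1 - (4 : ℝ) ^ (s - r)))⁻¹ *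
            L ^ 2) := by
          rw [← ENNReal.ofReal_one, ← ENNReal.ofReal_sub _ hρ0,
            ← ENNReal.ofReal_inv_of_pos (by linarith), ← ENNReal.ofReal_mul (by positivity)]
          congr 1
          field_simp
  -- Step 6: assemble
  calc ENNReal.ofReal (sobolevWeight s (0 : d → ℤ) ^ 2) * ‖mFourierCoeff f 0‖ₑ ^ 2 +
        (∑' k : d → ℤ, if k = 0 then 0 else
          ENNReal.ofReal (sobolevWeight s k ^ 2) * ‖mFourierCoeff f k‖ₑ ^ 2)
      ≤ ENNReal.ofReal (M ^ 2) + ENNReal.ofReal (Fintype.card d * A * (4 : ℝ) ^ (-(2 * r)) *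
          (2 * (1 - (4 : ℝ) ^ (s - r)))⁻¹ * L ^ 2) := add_le_add hzero (hregroup.trans hsum)
    _ = _ := by
        have h2 : (0 : ℝ) < (2 * (1 - (4 : ℝ) ^ (s - r)))⁻¹ := by rw [inv_pos]; linarith
        have h1 : (0 : ℝ) ≤ Fintype.card d := Nat.cast_nonneg _
        rw [← ENNReal.ofReal_add (by positivity) (by positivity)]

/-- **Bernstein's embedding `C^{0,r}(T^d) ⊂ H^s(T^d)`.** For `0 ≤ s < r` there is a constant
`C = C(d, s, r)` such that every continuous `f : T^d → F` with `‖f‖ ≤ M` and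
`‖f(x) - f(y)‖ ≤ L dist(x,y)^r` (`M, L ≥ 0`) has `‖f‖_{H^s} ≤ M + C L`
(Bahouri–Chemin–Danchin 2011, §2.7; Grafakos 2014, §3.3). [folklore] -/
theorem eSobolevNorm_le_of_holder (d : Type*) [Fintype d] {s r : ℝ} (hs : 0 ≤ s) (hsr : s < r) :
    ∃ C : ℝ, 0 ≤ C ∧ ∀ (f : UnitAddTorus d → F), Continuous f → ∀ (M L : ℝ), 0 ≤ M → 0 ≤ L →
      (∀ x, ‖f x‖ ≤ M) → (∀ x y, ‖f x - f y‖ ≤ L * dist x y ^ r) →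
        eSobolevNorm s f ≤ ENNReal.ofReal (M + C * L) := by
  set K : ℝ := Fintype.card d * (1 + 4 * Fintype.card d) ^ s * (4 : ℝ) ^ (-(2 * r)) *
    (2 * (1 - (4 : ℝ) ^ (s - r)))⁻¹ with hK
  have hρ : (4 : ℝ) ^ (s - r) < 1 := Real.rpow_lt_one_of_one_lt_of_neg (by norm_num) (by linarith)
  have hK0 : 0 ≤ K := by
    have h2 : (0 : ℝ) < (2 * (1 - (4 : ℝ) ^ (s - r)))⁻¹ := by rw [inv_pos]; linarith
    have h1 : (0 : ℝ) ≤ Fintype.card d := Nat.cast_nonneg _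
    positivity
  refine ⟨Real.sqrt K, Real.sqrt_nonneg K, fun f hfc M L hM hL hfM hfL => ?_⟩
  have hsq := eSobolevNorm_sq_le_of_holder hs hsr hfc hL hfM hfL
  have h1 : M ^ 2 + K * L ^ 2 ≤ (M + Real.sqrt K * L) ^ 2 := by
    have hs' : Real.sqrt K ^ 2 = K := Real.sq_sqrt hK0
    nlinarith [mul_nonneg (mul_nonneg hM (Real.sqrt_nonneg K)) hL]
  have h2 : eSobolevNorm s f ^ 2 ≤ ENNReal.ofReal ((M + Real.sqrt K * L) ^ 2) := by
    refine hsq.trans (ENNReal.ofReal_le_ofReal (le_trans (le_of_eq ?_) h1))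
    rw [hK]
  rw [ENNReal.ofReal_pow (by positivity)] at h2
  exact (ENNReal.pow_le_pow_left_iff two_ne_zero).1 h2

end Embedding

end Torus

end Literature.Analysis.FunctionSpaces

end
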